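import Literature.Analysis.FluidPDE.RadialCalculus
import Literature.Analysis.FluidPDE.PressurePoisson
import Literature.Analysis.FluidPDE.SpaceTimeMollifier
import Literature.Analysis.FluidPDE.SteadyLiouvilleTsaiKit
import Literature.Analysis.FluidPDE.KNSSLemma31Caloric
import Mathlib.MeasureTheory.Constructions.HaarToSphere
import Mathlib.MeasureTheory.Measure.Lebesgue.VolumeOfBalls
import HarnessLib

/-!
# The Stokes operator is not the Laplacian on a no-slip domain — fields file (the unit-ball
# witness; Foias–Manley–Rosa–Temam 2001 Ch. II §3 (3.7)–(3.8); Robinson–Rodrigo–Sadowski 2016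
# Def. 2.21, Thm. 2.22, Example 2.19, Exercise 2.8)

Support file (all results proved, standard axioms) of the barrier catalogue entry
`Literature.Barriers.NavierStokesRegularity.StokesOperatorNotLaplacian` (file
`StokesOperatorNotLaplacian.lean`, which carries the structured BARRIER block, the printed sources
and the cell rows it bears on). Kernel face at the P-free grain: the Helmholtz–Leray space `H(Ω)` of
a bounded domain is `L²(Ω)`-orthogonal to gradients, so «`PΔu = Δu` on `D(A) = V ∩ H²`»
[FoiasManleyRosaTemam2001, Ch. II §3 (3.8): `Au = −P_LΔu ≠ −Δu` in the no-slip case;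
RobinsonRodrigoSadowski2016, Def. 2.21 / Thm. 2.22 / Exercise 2.8] would force
`∫_Ω ⟪∇q, Δu⟫ = 0` for all smooth `q` and all smooth no-slip divergence-free `u`. On the unit ball
`B ⊂ ℝ³` the fields `w_a(x) = (1 − |x|²)((1 − 3|x|²) a + 2⟪a, x⟫ x) = M(|x|²) a + ∇(⟪a, x⟫ K(|x|²))`
(`M(s) = 1 − 5s + 7s²/2`, `K(s) = s − s²/2`) are smooth on `ℝ³`, divergence-free, zero on the unit
sphere, with `Δw_a = (56|x|² − 20) a − 28⟪a, x⟫ x` (`laplacian_wfld`), and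
`Σᵢ ∫_B ⟪∇⟪eᵢ,·⟫, Δw_{eᵢ}⟫ = ∫_B (140|x|² − 60) dx = 32π` (`sum_pairing_eq`); hence
`exists_noSlip_divFree_laplacian_not_orthogonal`. Also `laplacian_gradient_comm` (`Δ∇ = ∇Δ`: the
obstruction is the wall, not the interior). The calculus is ported from the cell's kernel file
`Theorems/SoloRefuteAtarka2026.lean` (ns-claims-refuter-7 g0 with ns-claims-typist-12 g2's kit;
Literature cannot import Summits), minus the claim-specific vocabulary.

## References

* [FoiasManleyRosaTemam2001] C. Foias, O. Manley, R. Rosa, R. Temam, *Navier–Stokes Equations and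
  Turbulence*, CUP 2001, Ch. II §3 (3.7)–(3.8) p. 38; §6 (6.2) p. 49–50.
* [RobinsonRodrigoSadowski2016] J. C. Robinson, J. L. Rodrigo, W. Sadowski, *The Three-Dimensional
  Navier–Stokes Equations*, CUP 2016, §2.2 Example 2.19 p. 56; §2.3 Def. 2.21, Thm. 2.22 p. 57–58;
  Exercise 2.8 p. 68–69.

WHAT THIS IS NOT: not a claim about NS regularity or blow-up; not a claim about any author beyond the
typed locator.
-/

noncomputable section

open Set Function MeasureTheory Metric InnerProductSpace
open scoped Topology ContDiff Laplacian RealInnerProductSpace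

namespace Literature.Barriers.NavierStokesRegularity

open Literature.Analysis.FluidPDE

namespace StokesCommutator

/-! ### Radial–linear calculus on `ℝ³` -/

/-- `∇⟪a, ·⟫ = a`. [cite: RobinsonRodrigoSadowski2016, §2.2 Example 2.19] -/
theorem gradient_inner_const_left (a x : EuclideanSpace ℝ (Fin 3)) :
    gradient (fun y : EuclideanSpace ℝ (Fin 3) => ⟪a, y⟫) x = a := by
  have h1 : HasFDerivAt (fun y : EuclideanSpace ℝ (Fin 3) => ⟪a, y⟫)
      (toDual ℝ (EuclideanSpace ℝ (Fin 3)) a) x := by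
    have : (fun y : EuclideanSpace ℝ (Fin 3) => ⟪a, y⟫) = toDual ℝ (EuclideanSpace ℝ (Fin 3)) a := by
      funext y; rfl
    rw [this]
    exact (toDual ℝ (EuclideanSpace ℝ (Fin 3)) a).hasFDerivAt
  unfold gradient
  rw [h1.fderiv, LinearIsometryEquiv.symm_apply_apply]

/-- `Δ⟪a, ·⟫ = 0`. [cite: RobinsonRodrigoSadowski2016, §2.3 Thm. 2.22] -/
theorem laplacian_innerLeft (a x : EuclideanSpace ℝ (Fin 3)) :
    (Δ (fun y : EuclideanSpace ℝ (Fin 3) => ⟪a, y⟫)) x = 0 := by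
  have hφ : ContDiff ℝ 2 (fun y : EuclideanSpace ℝ (Fin 3) => ⟪a, y⟫) :=
    (innerSL ℝ a : EuclideanSpace ℝ (Fin 3) →L[ℝ] ℝ).contDiff
  have hg : gradient (fun y : EuclideanSpace ℝ (Fin 3) => ⟪a, y⟫) = fun _ => a :=
    funext (gradient_inner_const_left a)
  rw [← divergence_gradient hφ, hg]
  simp [VectorCalculus.divergence]

/-- Gradient of `x ↦ ⟪a, x⟫ · P(‖x‖²)`: `P(‖x‖²) a + 2⟪a, x⟫ P'(‖x‖²) x`.
[cite: RobinsonRodrigoSadowski2016, §2.3 Exercise 2.8] -/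
theorem gradient_inner_mul {P P' : ℝ → ℝ} (hP : ∀ s, HasDerivAt P (P' s) s)
    (a x : EuclideanSpace ℝ (Fin 3)) :
    gradient (fun y : EuclideanSpace ℝ (Fin 3) => ⟪a, y⟫ * P (‖y‖ ^ 2)) x =
      P (‖x‖ ^ 2) • a + (2 * ⟪a, x⟫ * P' (‖x‖ ^ 2)) • x := by
  have h1 : HasFDerivAt (fun y : EuclideanSpace ℝ (Fin 3) => ⟪a, y⟫)
      (innerSL ℝ a : EuclideanSpace ℝ (Fin 3) →L[ℝ] ℝ) x :=
    (innerSL ℝ a : EuclideanSpace ℝ (Fin 3) →L[ℝ] ℝ).hasFDerivAt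
  have h2 := hasFDerivAt_comp_norm_sq (E := EuclideanSpace ℝ (Fin 3)) (hP (‖x‖ ^ 2))
  have h : HasFDerivAt (fun y : EuclideanSpace ℝ (Fin 3) => ⟪a, y⟫ * P (‖y‖ ^ 2))
      (⟪a, x⟫ • ((2 * P' (‖x‖ ^ 2)) • (innerSL ℝ x : EuclideanSpace ℝ (Fin 3) →L[ℝ] ℝ)) +
        P (‖x‖ ^ 2) • (innerSL ℝ a : EuclideanSpace ℝ (Fin 3) →L[ℝ] ℝ)) x := h1.mul h2
  rw [gradient, h.fderiv, map_add, map_smul, map_smul, map_smul]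
  have hx : (toDual ℝ (EuclideanSpace ℝ (Fin 3))).symm
      (innerSL ℝ x : EuclideanSpace ℝ (Fin 3) →L[ℝ] ℝ) = x :=
    (toDual ℝ (EuclideanSpace ℝ (Fin 3))).symm_apply_apply x
  have ha : (toDual ℝ (EuclideanSpace ℝ (Fin 3))).symm
      (innerSL ℝ a : EuclideanSpace ℝ (Fin 3) →L[ℝ] ℝ) = a :=
    (toDual ℝ (EuclideanSpace ℝ (Fin 3))).symm_apply_apply a
  rw [hx, ha, smul_smul, add_comm]
  congr 1
  ring

/-- Laplacian of `x ↦ ⟪a, x⟫ · P(‖x‖²)` on `ℝ³`: `⟪a, x⟫ (4‖x‖² P'' + 10 P')(‖x‖²)`.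
[cite: RobinsonRodrigoSadowski2016, §2.3 Exercise 2.8] -/
theorem laplacian_inner_mul {P P' P'' : ℝ → ℝ} (hP : ∀ s, HasDerivAt P (P' s) s)
    (hP' : ∀ s, HasDerivAt P' (P'' s) s) (hPs : ContDiff ℝ 2 P) (a x : EuclideanSpace ℝ (Fin 3)) :
    (Δ (fun y : EuclideanSpace ℝ (Fin 3) => ⟪a, y⟫ * P (‖y‖ ^ 2))) x =
      ⟪a, x⟫ * (4 * P'' (‖x‖ ^ 2) * ‖x‖ ^ 2 + 10 * P' (‖x‖ ^ 2)) := by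
  have hχ : ContDiff ℝ 2 (fun y : EuclideanSpace ℝ (Fin 3) => ⟪a, y⟫) :=
    (innerSL ℝ a : EuclideanSpace ℝ (Fin 3) →L[ℝ] ℝ).contDiff
  have hf : ContDiff ℝ 2 (fun y : EuclideanSpace ℝ (Fin 3) => P (‖y‖ ^ 2)) :=
    hPs.comp (contDiff_norm_sq ℝ)
  rw [Tsai2021.laplacian_mul_eq hχ hf x, laplacian_innerLeft,
    laplacian_comp_norm_sq isOpen_univ (fun s _ => hP s) (mem_univ _) (hP' _),
    finrank_euclideanSpace_fin]
  have e1 : ∀ i : Fin 3, fderiv ℝ (fun y : EuclideanSpace ℝ (Fin 3) => ⟪a, y⟫) x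
      (EuclideanSpace.single i 1) = ⟪a, EuclideanSpace.single i 1⟫ := fun i => by
    have hd : HasFDerivAt (fun y : EuclideanSpace ℝ (Fin 3) => ⟪a, y⟫)
        (innerSL ℝ a : EuclideanSpace ℝ (Fin 3) →L[ℝ] ℝ) x :=
      (innerSL ℝ a : EuclideanSpace ℝ (Fin 3) →L[ℝ] ℝ).hasFDerivAt
    rw [hd.fderiv]
    rfl
  have hpar := (EuclideanSpace.basisFun (Fin 3) ℝ).sum_inner_mul_inner a x
  simp only [EuclideanSpace.basisFun_apply] at hpar
  have hcross : ∑ i : Fin 3, fderiv ℝ (fun y : EuclideanSpace ℝ (Fin 3) => ⟪a, y⟫) x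
      (EuclideanSpace.single i 1) *
      fderiv ℝ (fun y : EuclideanSpace ℝ (Fin 3) => P (‖y‖ ^ 2)) x (EuclideanSpace.single i 1) =
      2 * P' (‖x‖ ^ 2) * ⟪a, x⟫ := by
    simp_rw [e1, fderiv_comp_norm_sq_apply (hP _)]
    rw [← hpar, Finset.mul_sum]
    refine Finset.sum_congr rfl fun i _ => ?_
    rw [real_inner_comm x]
    ring
  rw [hcross]
  push_cast
  ring

/-- `(toDual)⁻¹ : (ℝ³)* → ℝ³` as a continuous linear map (`∇ψ = (toDual)⁻¹ ∘ Dψ`).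
[cite: RobinsonRodrigoSadowski2016, §2.3 Def. 2.21] -/
abbrev dualInv : StrongDual ℝ (EuclideanSpace ℝ (Fin 3)) →L[ℝ] EuclideanSpace ℝ (Fin 3) :=
  ((toDual ℝ (EuclideanSpace ℝ (Fin 3))).symm :
    StrongDual ℝ (EuclideanSpace ℝ (Fin 3)) →L[ℝ] EuclideanSpace ℝ (Fin 3))

/-- `∇ψ = (toDual)⁻¹ ∘ Dψ`. [cite: RobinsonRodrigoSadowski2016, §2.3 Def. 2.21] -/
theorem gradient_eq_comp (ψ : EuclideanSpace ℝ (Fin 3) → ℝ) : gradient ψ = ⇑dualInv ∘ fderiv ℝ ψ := by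
  funext y; rfl

/-- The gradient of a smooth function is smooth. [cite: RobinsonRodrigoSadowski2016, §2.3 Def. 2.21] -/
theorem contDiff_gradient {ψ : EuclideanSpace ℝ (Fin 3) → ℝ} (hψ : ContDiff ℝ ∞ ψ) :
    ContDiff ℝ ∞ (gradient ψ) := by
  rw [gradient_eq_comp]
  exact dualInv.contDiff.comp (hψ.fderiv_right (m := ∞) (by norm_cast))

/-- `Δ∇ = ∇Δ` on smooth scalars (so `Δ` maps gradients to gradients: the obstruction below is not
in the interior). [cite: RobinsonRodrigoSadowski2016, §2.3 Thm. 2.22] -/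
theorem laplacian_gradient_comm {ψ : EuclideanSpace ℝ (Fin 3) → ℝ} (hψ : ContDiff ℝ ∞ ψ)
    (x : EuclideanSpace ℝ (Fin 3)) : (Δ (gradient ψ)) x = gradient (Δ ψ) x := by
  have h3 : ContDiff ℝ 3 ψ := hψ.of_le (by norm_cast)
  have hD : ContDiffAt ℝ 2 (fderiv ℝ ψ) x := (hψ.fderiv_right (m := 2) (by norm_cast)).contDiffAt
  rw [gradient_eq_comp ψ, hD.laplacian_CLM_comp_left, Function.comp_apply,
    laplacian_fderiv_eq_fderiv_laplacian h3]
  rfl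

/-! ### The no-slip test fields `w_a` on the unit ball -/

/-- Radial profile of the potential: `K(s) = s − s²/2`. [cite: RobinsonRodrigoSadowski2016, §2.3 Exercise 2.8] -/
def Kf (s : ℝ) : ℝ := s - s ^ 2 / 2

/-- Radial profile of the constant-direction part: `M(s) = 1 − 5s + 7s²/2`.
[cite: RobinsonRodrigoSadowski2016, §2.3 Exercise 2.8] -/
def Mf (s : ℝ) : ℝ := 1 - 5 * s + 7 / 2 * s ^ 2

/-- `K' = 1 − s`. [cite: RobinsonRodrigoSadowski2016, §2.3 Exercise 2.8] -/
theorem hasDerivAt_Kf (s : ℝ) : HasDerivAt Kf (1 - s) s := by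
  have h1 : HasDerivAt (fun t : ℝ => t ^ 2 / 2) ((2 : ℕ) * s ^ (2 - 1) / 2) s :=
    (hasDerivAt_pow 2 s).div_const 2
  have h : HasDerivAt (fun t : ℝ => t - t ^ 2 / 2) (1 - (2 : ℕ) * s ^ (2 - 1) / 2) s :=
    (hasDerivAt_id' s).sub h1
  refine h.congr_deriv ?_
  norm_num

/-- `M' = 7s − 5`. [cite: RobinsonRodrigoSadowski2016, §2.3 Exercise 2.8] -/
theorem hasDerivAt_Mf (s : ℝ) : HasDerivAt Mf (7 * s - 5) s := by
  have h1 : HasDerivAt (fun t : ℝ => 1 - 5 * t) (-(5 * 1)) s :=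
    ((hasDerivAt_id' s).const_mul (5 : ℝ)).const_sub 1
  have h2 : HasDerivAt (fun t : ℝ => 7 / 2 * t ^ 2) (7 / 2 * ((2 : ℕ) * s ^ (2 - 1))) s :=
    (hasDerivAt_pow 2 s).const_mul (7 / 2)
  have h : HasDerivAt (fun t : ℝ => 1 - 5 * t + 7 / 2 * t ^ 2)
      (-(5 * 1) + 7 / 2 * ((2 : ℕ) * s ^ (2 - 1))) s := h1.add h2
  refine h.congr_deriv ?_
  norm_num
  ring

/-- `R(s) = 10 − 14s` (so that `Δφ_a = ⟪a, ·⟫ R(‖·‖²)`). [cite: RobinsonRodrigoSadowski2016, §2.3 Exercise 2.8] -/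
def Rf (s : ℝ) : ℝ := 10 - 14 * s

/-- `R' = −14`. [cite: RobinsonRodrigoSadowski2016, §2.3 Exercise 2.8] -/
theorem hasDerivAt_Rf (s : ℝ) : HasDerivAt Rf (-14) s := by
  have h : HasDerivAt (fun t : ℝ => 10 - 14 * t) (-(14 * 1)) s :=
    ((hasDerivAt_id' s).const_mul (14 : ℝ)).const_sub 10
  refine h.congr_deriv ?_
  norm_num

/-- `K` is smooth. [cite: RobinsonRodrigoSadowski2016, §2.3 Exercise 2.8] -/
theorem contDiff_Kf : ContDiff ℝ ∞ Kf := by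
  unfold Kf; fun_prop

/-- `M` is smooth. [cite: RobinsonRodrigoSadowski2016, §2.3 Exercise 2.8] -/
theorem contDiff_Mf : ContDiff ℝ ∞ Mf := by
  unfold Mf; fun_prop

/-- The potential `φ_a(x) = ⟪a, x⟫ K(‖x‖²)`. [cite: RobinsonRodrigoSadowski2016, §2.3 Exercise 2.8] -/
def phi (a : EuclideanSpace ℝ (Fin 3)) : EuclideanSpace ℝ (Fin 3) → ℝ :=
  fun x => ⟪a, x⟫ * Kf (‖x‖ ^ 2)

/-- The test field `w_a(x) = M(‖x‖²) a + ∇φ_a(x)` (`= (1 − ‖x‖²)((1 − 3‖x‖²) a + 2⟪a, x⟫ x)`).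
[cite: RobinsonRodrigoSadowski2016, §2.3 Exercise 2.8] -/
def wfld (a : EuclideanSpace ℝ (Fin 3)) : EuclideanSpace ℝ (Fin 3) → EuclideanSpace ℝ (Fin 3) :=
  fun x => Mf (‖x‖ ^ 2) • a + gradient (phi a) x

/-- `φ_a` is smooth. [cite: RobinsonRodrigoSadowski2016, §2.3 Exercise 2.8] -/
theorem contDiff_phi (a : EuclideanSpace ℝ (Fin 3)) : ContDiff ℝ ∞ (phi a) :=
  ((innerSL ℝ a : EuclideanSpace ℝ (Fin 3) →L[ℝ] ℝ).contDiff).mul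
    (contDiff_Kf.comp (contDiff_norm_sq ℝ))

/-- `x ↦ M(‖x‖²)` is smooth. [cite: RobinsonRodrigoSadowski2016, §2.3 Exercise 2.8] -/
theorem contDiff_Mf_norm_sq : ContDiff ℝ ∞ (fun x : EuclideanSpace ℝ (Fin 3) => Mf (‖x‖ ^ 2)) :=
  contDiff_Mf.comp (contDiff_norm_sq ℝ)

/-- `∇φ_a(x) = K(‖x‖²) a + 2⟪a, x⟫(1 − ‖x‖²) x`. [cite: RobinsonRodrigoSadowski2016, §2.3 Exercise 2.8] -/
theorem gradient_phi (a x : EuclideanSpace ℝ (Fin 3)) :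
    gradient (phi a) x = Kf (‖x‖ ^ 2) • a + (2 * ⟪a, x⟫ * (1 - ‖x‖ ^ 2)) • x :=
  gradient_inner_mul hasDerivAt_Kf a x

/-- `Δφ_a(x) = ⟪a, x⟫ (10 − 14‖x‖²)`. [cite: RobinsonRodrigoSadowski2016, §2.3 Exercise 2.8] -/
theorem laplacian_phi (a : EuclideanSpace ℝ (Fin 3)) :
    Δ (phi a) = fun x : EuclideanSpace ℝ (Fin 3) => ⟪a, x⟫ * Rf (‖x‖ ^ 2) := by
  funext x
  have h := laplacian_inner_mul (P'' := fun _ => (-1 : ℝ)) hasDerivAt_Kf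
    (fun s => (hasDerivAt_id' s).const_sub (1 : ℝ)) (contDiff_Kf.of_le (by norm_cast)) a x
  rw [show phi a = fun y : EuclideanSpace ℝ (Fin 3) => ⟪a, y⟫ * Kf (‖y‖ ^ 2) from rfl, h]
  simp only [Rf]
  ring

/-- `w_a` is smooth on `ℝ³`. [cite: RobinsonRodrigoSadowski2016, §2.3 Exercise 2.8] -/
theorem contDiff_wfld (a : EuclideanSpace ℝ (Fin 3)) : ContDiff ℝ ∞ (wfld a) :=
  (contDiff_Mf_norm_sq.smul contDiff_const).add (contDiff_gradient (contDiff_phi a))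

/-- `∇ · w_a = 0` everywhere. [cite: RobinsonRodrigoSadowski2016, §2.3 Exercise 2.8] -/
theorem divergence_wfld (a x : EuclideanSpace ℝ (Fin 3)) :
    VectorCalculus.divergence (wfld a) x = 0 := by
  have hM : DifferentiableAt ℝ (fun y : EuclideanSpace ℝ (Fin 3) => Mf (‖y‖ ^ 2)) x :=
    (contDiff_Mf_norm_sq.differentiable (by norm_cast)) x
  have hG : DifferentiableAt ℝ (gradient (phi a)) x :=
    ((contDiff_gradient (contDiff_phi a)).differentiable (by norm_cast)) x
  show VectorCalculus.divergence
      (fun y : EuclideanSpace ℝ (Fin 3) => Mf (‖y‖ ^ 2) • a + gradient (phi a) y) x = 0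
  rw [divergence_add_apply (hM.smul_const a) hG, divergence_smul_const a hM,
    fderiv_comp_norm_sq_apply (hasDerivAt_Mf _),
    divergence_gradient ((contDiff_phi a).of_le (by norm_cast)), laplacian_phi, real_inner_comm a x]
  simp only [Rf]
  ring

/-- `w_a` vanishes on the unit sphere (no-slip). [cite: RobinsonRodrigoSadowski2016, §2.3 Exercise 2.8] -/
theorem wfld_eq_zero_of_norm (a : EuclideanSpace ℝ (Fin 3)) {x : EuclideanSpace ℝ (Fin 3)}
    (hx : ‖x‖ = 1) : wfld a x = 0 := by
  show Mf (‖x‖ ^ 2) • a + gradient (phi a) x = 0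
  rw [gradient_phi, hx, ← add_assoc, ← add_smul]
  norm_num [Mf, Kf]

/-- `Δw_a(x) = (56‖x‖² − 20) a − 28⟪a, x⟫ x`. [cite: RobinsonRodrigoSadowski2016, §2.3 Exercise 2.8] -/
theorem laplacian_wfld (a x : EuclideanSpace ℝ (Fin 3)) :
    (Δ (wfld a)) x = (56 * ‖x‖ ^ 2 - 20) • a + (-(28 * ⟪a, x⟫)) • x := by
  have e : wfld a = (fun y : EuclideanSpace ℝ (Fin 3) => Mf (‖y‖ ^ 2) • a) + gradient (phi a) := rfl
  have h1 : ContDiffAt ℝ 2 (fun y : EuclideanSpace ℝ (Fin 3) => Mf (‖y‖ ^ 2) • a) x :=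
    ((contDiff_Mf_norm_sq.smul contDiff_const).of_le (by norm_cast)).contDiffAt
  have h2 : ContDiffAt ℝ 2 (gradient (phi a)) x :=
    ((contDiff_gradient (contDiff_phi a)).of_le (by norm_cast)).contDiffAt
  rw [e, h1.laplacian_add h2, laplacian_smul_const (contDiff_Mf_norm_sq.of_le (by norm_cast)),
    laplacian_comp_norm_sq (g₂ := (7 : ℝ)) isOpen_univ (fun s _ => hasDerivAt_Mf s) (mem_univ _)
      (by simpa using ((hasDerivAt_id' (‖x‖ ^ 2)).const_mul (7 : ℝ)).sub_const (5 : ℝ)),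
    finrank_euclideanSpace_fin, laplacian_gradient_comm (contDiff_phi a), laplacian_phi,
    gradient_inner_mul hasDerivAt_Rf a x]
  simp only [Rf]
  push_cast
  module

/-- The pairing of `Δw_a` with `∇⟪a, ·⟫ = a`: `(56‖x‖² − 20)‖a‖² − 28⟪a, x⟫²`.
[cite: RobinsonRodrigoSadowski2016, §2.3 Exercise 2.8] -/
theorem inner_gradient_laplacian_wfld (a x : EuclideanSpace ℝ (Fin 3)) :
    ⟪gradient (fun y : EuclideanSpace ℝ (Fin 3) => ⟪a, y⟫) x, (Δ (wfld a)) x⟫ =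
      (56 * ‖x‖ ^ 2 - 20) * ‖a‖ ^ 2 - 28 * ⟪a, x⟫ ^ 2 := by
  rw [gradient_inner_const_left, laplacian_wfld, inner_add_right, inner_smul_right, inner_smul_right,
    real_inner_self_eq_norm_sq]
  ring

/-! ### The ball moment `∫_B (140‖x‖² − 60) dx = 32π ≠ 0` -/

/-- `∫_{B(0,1)} (140‖x‖² − 60) dx = 32π` (polar coordinates, `|B(0,1)| = 4π/3`).
[cite: RobinsonRodrigoSadowski2016, §2.3 Exercise 2.8] -/
theorem integral_ball_moment :
    ∫ x in ball (0 : EuclideanSpace ℝ (Fin 3)) 1, (140 * ‖x‖ ^ 2 - 60) = 32 * Real.pi := by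
  set g : ℝ → ℝ := fun r => if r < 1 then 140 * r ^ 2 - 60 else 0 with hg
  have hind : (ball (0 : EuclideanSpace ℝ (Fin 3)) 1).indicator
      (fun x : EuclideanSpace ℝ (Fin 3) => 140 * ‖x‖ ^ 2 - 60) = fun x => g ‖x‖ := by
    funext x
    by_cases hx : x ∈ ball (0 : EuclideanSpace ℝ (Fin 3)) 1
    · rw [Set.indicator_of_mem hx]
      rw [mem_ball_zero_iff] at hx
      simp [hg, hx]
    · rw [Set.indicator_of_notMem hx]
      rw [mem_ball_zero_iff, not_lt] at hx
      simp [hg, not_lt.2 hx]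
  have hrad : ∀ r ∈ Ioi (0 : ℝ), r ^ (3 - 1) • g r =
      (Iio (1 : ℝ)).indicator (fun r => 140 * r ^ 4 - 60 * r ^ 2) r := by
    intro r _
    by_cases h1 : r < 1
    · rw [Set.indicator_of_mem (show r ∈ Iio (1 : ℝ) from h1), smul_eq_mul]
      simp only [hg, if_pos h1]
      ring
    · rw [Set.indicator_of_notMem (show r ∉ Iio (1 : ℝ) from h1), smul_eq_mul]
      simp [hg, if_neg h1]
  have hdim : Module.finrank ℝ (EuclideanSpace ℝ (Fin 3)) = 3 := finrank_euclideanSpace_fin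
  have hball : (volume : Measure (EuclideanSpace ℝ (Fin 3))).real (ball 0 1) = Real.pi * 4 / 3 := by
    rw [Measure.real, EuclideanSpace.volume_ball_fin_three, ENNReal.ofReal_one, one_pow, one_mul,
      ENNReal.toReal_ofReal (by positivity)]
  have hI : ∫ r in Ioo (0 : ℝ) 1, (140 * r ^ 4 - 60 * r ^ 2) = 8 := by
    rw [← integral_Ioc_eq_integral_Ioo, ← intervalIntegral.integral_of_le zero_le_one,
      intervalIntegral.integral_sub, intervalIntegral.integral_const_mul,
      intervalIntegral.integral_const_mul, integral_pow, integral_pow]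
    · norm_num
    · exact (continuous_const.mul (continuous_pow 4)).intervalIntegrable _ _
    · exact (continuous_const.mul (continuous_pow 2)).intervalIntegrable _ _
  rw [← integral_indicator measurableSet_ball, hind, integral_fun_norm_addHaar volume g, hdim, hball,
    setIntegral_congr_fun measurableSet_Ioi hrad, setIntegral_indicator measurableSet_Iio,
    Set.Ioi_inter_Iio, hI, smul_eq_mul, nsmul_eq_mul]
  push_cast
  ring

/-- Each single-direction integrand is integrable on the ball.
[cite: RobinsonRodrigoSadowski2016, §2.3 Exercise 2.8] -/
theorem integrableOn_pairing (a : EuclideanSpace ℝ (Fin 3)) :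
    IntegrableOn (fun x : EuclideanSpace ℝ (Fin 3) => (56 * ‖x‖ ^ 2 - 20) * ‖a‖ ^ 2 - 28 * ⟪a, x⟫ ^ 2)
      (ball (0 : EuclideanSpace ℝ (Fin 3)) 1) := by
  have hc : Continuous fun x : EuclideanSpace ℝ (Fin 3) =>
      (56 * ‖x‖ ^ 2 - 20) * ‖a‖ ^ 2 - 28 * ⟪a, x⟫ ^ 2 := by
    fun_prop
  exact (hc.continuousOn.integrableOn_compact (isCompact_closedBall (0 : EuclideanSpace ℝ (Fin 3)) 1)).mono_set
    ball_subset_closedBall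

/-- Summing the three coordinate directions: `Σᵢ [(56‖x‖² − 20) − 28 xᵢ²] = 140‖x‖² − 60`.
[cite: RobinsonRodrigoSadowski2016, §2.3 Exercise 2.8] -/
theorem sum_pairing_single (x : EuclideanSpace ℝ (Fin 3)) :
    ∑ i : Fin 3, ((56 * ‖x‖ ^ 2 - 20) * ‖EuclideanSpace.single i (1 : ℝ)‖ ^ 2 -
      28 * ⟪EuclideanSpace.single i (1 : ℝ), x⟫ ^ 2) = 140 * ‖x‖ ^ 2 - 60 := by
  have hn : ∀ i : Fin 3, ‖EuclideanSpace.single i (1 : ℝ)‖ = 1 := fun i => by simp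
  simp only [hn, EuclideanSpace.inner_single_left, one_pow, mul_one, map_one, one_mul]
  rw [EuclideanSpace.real_norm_sq_eq x, Fin.sum_univ_three, Fin.sum_univ_three]
  ring

/-- **The summed pairing is `32π`**: `Σᵢ ∫_B ⟪∇⟪eᵢ, ·⟫, Δw_{eᵢ}⟫ dx = 32π`.
[cite: RobinsonRodrigoSadowski2016, §2.3 Exercise 2.8] -/
theorem sum_pairing_eq :
    ∑ i : Fin 3, ∫ x in ball (0 : EuclideanSpace ℝ (Fin 3)) 1,
      ⟪gradient (fun y : EuclideanSpace ℝ (Fin 3) => ⟪EuclideanSpace.single i (1 : ℝ), y⟫) x,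
        (Δ (wfld (EuclideanSpace.single i (1 : ℝ)))) x⟫ = 32 * Real.pi := by
  simp_rw [inner_gradient_laplacian_wfld]
  rw [← integral_finsetSum _ fun i _ => integrableOn_pairing _, ← integral_ball_moment]
  refine setIntegral_congr_fun measurableSet_ball fun x _ => ?_
  exact sum_pairing_single x

/-- **Some no-slip, divergence-free, smooth field on the unit ball has a Laplacian that is NOT
`L²(B)`-orthogonal to gradients** — so `Δu ∉ H(B)`, `PΔu ≠ Δu = ΔPu`: the Leray projector of the
no-slip ball does not commute with the Laplacian and the Stokes operator `A = −PΔ` is not `−Δ` on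
`D(A) = V ∩ H²`. [cite: FoiasManleyRosaTemam2001, Ch. II §3 eqs. (3.7)–(3.8) p. 38] -/
theorem exists_noSlip_divFree_laplacian_not_orthogonal :
    ∃ (u : EuclideanSpace ℝ (Fin 3) → EuclideanSpace ℝ (Fin 3)) (q : EuclideanSpace ℝ (Fin 3) → ℝ),
      ContDiff ℝ ∞ u ∧ ContDiff ℝ ∞ q ∧ (∀ x, VectorCalculus.divergence u x = 0) ∧
        (∀ x, ‖x‖ = 1 → u x = 0) ∧
          ∫ x in ball (0 : EuclideanSpace ℝ (Fin 3)) 1, ⟪gradient q x, (Δ u) x⟫ ≠ 0 := by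
  by_contra hall
  push Not at hall
  have hzero : ∀ i : Fin 3, ∫ x in ball (0 : EuclideanSpace ℝ (Fin 3)) 1,
      ⟪gradient (fun y : EuclideanSpace ℝ (Fin 3) => ⟪EuclideanSpace.single i (1 : ℝ), y⟫) x,
        (Δ (wfld (EuclideanSpace.single i (1 : ℝ)))) x⟫ = 0 := fun i =>
    hall _ _ (contDiff_wfld _) (innerSL ℝ (EuclideanSpace.single i (1 : ℝ)) :
      EuclideanSpace ℝ (Fin 3) →L[ℝ] ℝ).contDiff (divergence_wfld _) (fun x hx => wfld_eq_zero_of_norm _ hx)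
  have hsum := sum_pairing_eq
  rw [Finset.sum_eq_zero fun i _ => hzero i] at hsum
  have : (0 : ℝ) < 32 * Real.pi := by positivity
  linarith

end StokesCommutator

end Literature.Barriers.NavierStokesRegularity

end
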